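import Summits.ResolutionOfSingularities.ResolutionOfSingularities.Theorems.SatelliteExitClasses

/-!
# SatelliteExitKernels — node «SatelliteExit» (decomp-res N61, lens-6 g11 sha256 9ab96153cd7d95fd): Theses-free kernels

§5 of the lens: the RECURRENCE CERTIFICATES answering the critic's test T-sat-tower-3x (`satelliteRecurs_w/x/xyzw`,
ring identities: the pure cube head `z³ + xy²w + xyzw` reproduces verbatim along the alternating `∂_w/∂_x` point
tower — so «satellite moves cannot recur» is FALSE pointwise, and the g10 located residual `WORPureSat3` is honestly
SUPERSEDED by the branch typing of `SatelliteExitClasses`); and the Theses-free half of §6: `WORPure 3` from the g11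
pieces (`worPure_three_of_g11`), necessity (`elim_of_e_one`), the forced shadow `PureForcedTowersTerminate3` of the
residual and its necessity modulo the tree port `TowerObstructs 3` (`pureForced_of_worPure`).  The wiring to the
route items is `Theorems/MaxContactCutSatelliteExit`.  (Sources: CossartPiltant2008 §4; Moh1987; CossartJannsenSaito2020
Cor 5.37.)
-/

namespace Summit.ResolutionOfSingularities.ResolutionOfSingularities.Theorems.SatelliteExitKernels

open CategoryTheory AlgebraicGeometry
open Literature.AlgebraicGeometry.Resolution
open Summit.ResolutionOfSingularities.ResolutionOfSingularities.Theorems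
open WeakOrderReduction ForcedTowerClasses PurityValveClasses FrobeniusBracketPow MonomialTowerClasses
open DivergentTowerClasses
open SatelliteExitClasses

/-! ## §5 Asides (PROVED): the recurrence certificates answering T-sat-tower-3x -/

/-- **SATELLITE RECURRENCE, chart `w`**: the pure cube head `f = z³ + xy²w + xyzw` reproduces verbatim under the
controlled chart transform at the `∂_w`-child: `f(xw, yw, zw, w) = w³·f`. [folklore] -/
theorem satelliteRecurs_w {R : Type*} [CommRing R] (x y z w : R) :
    (z * w) ^ 3 + (x * w) * (y * w) ^ 2 * w + (x * w) * (y * w) * (z * w) * w =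
      w ^ 3 * (z ^ 3 + x * y ^ 2 * w + x * y * z * w) := by
  ring

/-- **SATELLITE RECURRENCE, chart `x`**: `f(x, yx, zx, wx) = x³·f` — so the alternating `∂_w, ∂_x, ∂_w, …` point
tower over `f` is an infinite all-newest-satellite PURE core tower (each child lies on the strict transform `{u = 0}`
of the previous exceptional divisor); it is NOT escaping: the axis `{u = y = z = 0}` has `ν = 3` at every stage.
[folklore] -/
theorem satelliteRecurs_x {R : Type*} [CommRing R] (x y z w : R) :
    (z * x) ^ 3 + x * (y * x) ^ 2 * (w * x) + x * (y * x) * (z * x) * (w * x) =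
      x ^ 3 * (z ^ 3 + x * y ^ 2 * w + x * y * z * w) := by
  ring

/-- The simpler recurrent head `z³ + xyzw` (impure-looking but Hasse `[x²y²w²](xyw)² = 1`, pure): same identities.
[folklore] -/
theorem satelliteRecurs_xyzw {R : Type*} [CommRing R] (x y z w : R) :
    (z * w) ^ 3 + (x * w) * (y * w) * (z * w) * w = w ^ 3 * (z ^ 3 + x * y * z * w) ∧
    (z * x) ^ 3 + x * (y * x) * (z * x) * (w * x) = x ^ 3 * (z ^ 3 + x * y * z * w) := by
  constructor <;> ring

/-! ## §6 (Theses-free part)  `WORPure 3` from the pieces; necessity; the forced shadow -/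

/-- `WORPure 3` from the g11 pieces (the two residual leaves as hypotheses, the decided leaves as hypotheses to be
discharged by their desk proofs, the engine port, the booked finish). [folklore] -/
theorem worPure_three_of_g11 (hE : PureEngine3) (h23 : SeqDimFour 2 3) (hU : FrameUnstable3) (hF : ShadowFree3)
    (hR : ShadowRegular3) (hS : ShadowSingular3) : WORPure 3 :=
  worPure_of_engine hE h23 (noEscaping_of_leaves hU hF hR hS)

/-- `PureCoreElimination3` and all four leaves' PARENT are `WORPure 3`-implied resp. imply it only jointly; the
scheme-level necessity is `elim_of_worPure`; hence `E 1`-implied. [folklore] -/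
theorem elim_of_e_one (hS : BaseStable) (h : E 1) : PureCoreElimination3 :=
  elim_of_worPure hS (worPure_of_wor (wor_of_seqDimFour_one (h 3 (by norm_num))))

/-- **aside · `PureForcedTowersTerminate3`** — no infinite FORCED point tower (tree structure `ForcedTower`) starts at a
marking-3 datum all of whose core points are pure.  The forced shadow of the g11 residual (a forced tower through
pure cube points is an escaping branch with no foreign rounds).  TARGET-IMPLIED mod the tree port `TowerObstructs 3`
(kernel `pureForced_of_worPure`). (Sources: Moh1987; CossartPiltant2008, §4.) -/
def PureForcedTowersTerminate3 : Prop :=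
  ∀ p : ℕ, p.Prime → ∀ (k : Type) [Field k] [CharP k p] (T : ForcedTower) (g : T.St 0 ⟶ Spec (.of k))
    (hB : IsBase (T.St 0) g), IsDatum 3 (T.D 0) → AllCorePure p g hB.isRegular (T.D 0).ideal 3 → False

/-- NECESSITY of the forced shadow: `TowerObstructs 3 → WORPure 3 → PureForcedTowersTerminate3`. [folklore] -/
theorem pureForced_of_worPure (hT : TowerObstructs 3) (h : WORPure 3) : PureForcedTowersTerminate3 :=
  fun p hp k _ _ T g hB hD hA => hT p hp k T g hB hD (h p hp k (T.St 0) g hB (T.D 0) hD hA)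

end Summit.ResolutionOfSingularities.ResolutionOfSingularities.Theorems.SatelliteExitKernels
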